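/-
Copyright: the b2b-balaban T⁴-continuum CRUX team, row NE7b OWNER lineage `t4-ne7b-p1` (gen 110). Project licence.
-/
import Summits.QuantumFields.BalabanUV.T4Continuum.Spine.NE7b.FluctuationStepMarginal
import Summits.QuantumFields.BalabanUV.T4Continuum.Spine.NE7b.FluctuationStepGrowth
import Summits.QuantumFields.BalabanUV.T4Continuum.Spine.NE7b.FluctuationStepDeriv

/-!
# THE LETTERS OF THE NEXT ACTION AFTER ONE FLUCTUATION STEP, FROM THE STEP's DATA ALONE: two-sided Taylor control of
# `V⁺ ψ = −log ∫_{K₂} e^{−V(φ) − G(ψ − Qφ)} dφ` about EVERY point — first-order lower letter with modulus `aσ∕(σ + aκ²)` and upper letter with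
# the fluctuation weight's growth constant, SAME linear term `DV⁺(ψ₀)` (row NE7b, node U5c; (R2′) family (2), letters (ℓ1) + (ℓ2) by value)

Cell `pub-balaban`, sub-cell `t4`, spine estimate NE7b (`T4WeightBudget.RelWeightBound`; the cell's OWN estimate — NOT PRINTED in
[Bałaban 1983–89], NOT PROVED).  Crux-route work under `Spine/NE7b/` by the row's OWNER; NOTHING of Bałaban's is named or asserted; no
`T4Continuum/Support` leaf typed; no `def`; zero `sorry`.  Imports: the OWNER's (31) `…FluctuationStepMarginal`, (32) `…FluctuationStepGrowth`,
(33) `…FluctuationStepDeriv` (hence (26), (29), (30)).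

WHY.  The road's sockets consume, per step, a FIRST-ORDER lower letter `W x + DW(x)(y − x) + (λ∕2)‖y − x‖² ≤ W y` ON the window
(`…ConvexWindowSuppliers`, `…ConvexWindowTiltRecentred`, …) and a growth letter `W y ≤ W x₀ + DW(x₀)(y − x₀) + b‖y − x₀‖²`
(`…ConvexWindowTaylorGrowth`, `…ConvexWindowExponentShift`).  For the next action of a renormalisation step both are now theorems of the
step's data: (31) gives `StrongConvexOn` with `λ⁺ = aσ∕(σ + aκ²)`, (33) gives the derivative `DV⁺(ψ₀)` at every point (so (26) §5 converts
the secant letter into the first-order one EVERYWHERE), and (32) gives the growth letter with the SAME linear term.  THIS FILE is the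
three-line assembly, so that an instance reads the pair of letters for `V⁺` off ONE theorem with no hypothesis beyond: `K₂` convex,
measurable, bounded, of positive volume; `V` continuous and `σ`-convex on `K₂`; `G ∈ C¹`, `a`-convex with growth constant `b`; `‖Q‖ ≤ κ`.

WHAT IS PROVED ([folklore]):
* §1 **`stepMarginal_firstOrder`** — for all `ψ, ψ'`: `V⁺ψ + DV⁺(ψ)(ψ' − ψ) + (aσ∕(σ+aκ²))∕2·‖ψ' − ψ‖² ≤ V⁺ψ'`, `DV⁺(ψ)` the displayed tilted
  mean of `DG(ψ − Q·)` ((31) + (33) + (26) §5).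
* §2 **`stepMarginal_twoSided`** — with the weight's growth letter (constant `b`): the pair (lower §1, upper (32)) about every `ψ`.
* §3 **`gaussianStepMarginal_twoSided`** — `G = (a∕2)‖·‖²`, `0 ≤ a`: modulus `aσ∕(σ + aκ²)` below, growth `a∕2` above, linear term
  `v ↦ a⟪ψ − Qφ̄, v⟫` — the next action of a Gaussian step is pinched by the three numbers `(σ, a, κ)`.

NOT HERE (honest): which `V`, `G`, `Q`, `K₂`, `(σ, a, κ, b)` Bałaban's steps display, in which chart ((A3) ∕ (A1c); NC-NE7b-α UNRULED); windows
on the NEW field (restrict with (27)); anything of Bałaban's.  BY-NAME EFFECT ON THE WALL: NONE.  NE7b NOT PRINTED ∕ NOT PROVED; spine PROVED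
0∕9; rung (B)+1 on a FINITE torus — NOT infinite volume, NOT the mass gap, NOT Clay.
HONEST DEPENDENCY: continuum YM on T⁴ ⇐ BetaPertH ∧ nine spine estimates (0/9 proved); BetaPertH ⇐ (D1) ∧ (D4) ∧ CAP+tail.
-/

set_option autoImplicit false

noncomputable section

open MeasureTheory Real Set Bornology
open scoped RealInnerProductSpace
open Summit.QuantumFields.BalabanUV.T4Continuum.NE7b.LogConcaveMarginal
open Summit.QuantumFields.BalabanUV.T4Continuum.NE7b.FluctuationStepMarginal
open Summit.QuantumFields.BalabanUV.T4Continuum.NE7b.FluctuationStepGrowth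
open Summit.QuantumFields.BalabanUV.T4Continuum.NE7b.FluctuationStepDeriv

namespace Summit.QuantumFields.BalabanUV.T4Continuum.NE7b.FluctuationStepLetters

variable {m n : ℕ}

/-! ## §1 The first-order lower letter of the next action, everywhere -/

/-- **THE SOCKETS' FIRST-ORDER LETTER FOR THE NEXT ACTION, NO SIDE LETTER.**  `K₂ ⊆ ℝⁿ` convex, measurable, bounded, of positive volume;
`V` continuous and `σ`-strongly convex on `K₂` (`σ ≥ 0`); `G ∈ C¹(ℝᵐ)` and `a`-strongly convex on `ℝᵐ`; `‖Qφ‖ ≤ κ‖φ‖`; `σ + aκ² > 0`.  With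
`U(ψ, φ) = V φ + G(ψ − Qφ)`, `V⁺ ψ = −log ∫_{K₂} e^{−U(ψ,φ)} dφ` and `DV⁺(ψ) = (∫_{K₂} e^{−U(ψ,·)})⁻¹ • ∫_{K₂} e^{−U(ψ,φ)} • DG(ψ − Qφ) dφ`:
for ALL `ψ, ψ'`, `V⁺ψ + DV⁺(ψ)(ψ' − ψ) + (aσ∕(σ+aκ²))∕2·‖ψ' − ψ‖² ≤ V⁺ψ'`. [folklore] -/
theorem stepMarginal_firstOrder {K₂ : Set (EuclideanSpace ℝ (Fin n))} (hK₂m : MeasurableSet K₂) (hK₂c : Convex ℝ K₂)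
    (hK₂b : IsBounded K₂) (hK₂v : 0 < volume K₂)
    {V : EuclideanSpace ℝ (Fin n) → ℝ} {G : EuclideanSpace ℝ (Fin m) → ℝ} (hVc : Continuous V) (hG1 : ContDiff ℝ 1 G)
    {a σ κ : ℝ} (hV : StrongConvexOn K₂ σ V) (hG : StrongConvexOn univ a G) (hσ : 0 ≤ σ) (hD : 0 < σ + a * κ ^ 2)
    (Q : EuclideanSpace ℝ (Fin n) →ₗ[ℝ] EuclideanSpace ℝ (Fin m)) (hQ : ∀ y, ‖Q y‖ ≤ κ * ‖y‖) (x x' : EuclideanSpace ℝ (Fin m)) :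
    -log (∫ y in K₂, exp (-(V y + G (x - Q y)))) +
        ((∫ y in K₂, exp (-(V y + G (x - Q y))))⁻¹ • ∫ y in K₂, exp (-(V y + G (x - Q y))) • fderiv ℝ G (x - Q y)) (x' - x) +
        a * σ / (σ + a * κ ^ 2) / 2 * ‖x' - x‖ ^ 2 ≤
      -log (∫ y in K₂, exp (-(V y + G (x' - Q y)))) :=
  firstOrder_of_strongConvexOn_hasFDerivAt
    (strongConvexOn_neg_log_stepMarginal_of_isBounded hK₂m hK₂c hK₂b hK₂v hVc hG1.continuous hV hG hσ hD Q hQ convex_univ)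
    (mem_univ x) (mem_univ x') (hasFDerivAt_neg_log_stepIntegral hK₂m hK₂b hK₂v hVc hG1 Q x)

/-! ## §2 The two-sided control about every point -/

/-- **TWO-SIDED TAYLOR CONTROL OF THE NEXT ACTION FROM THE STEP's DATA.**  Under §1's hypotheses and the weight's growth letter
`G w' ≤ G w + DG(w)(w' − w) + b‖w' − w‖²`: for all `ψ, ψ'`,
`V⁺ψ + DV⁺(ψ)(ψ' − ψ) + (aσ∕(σ+aκ²))∕2·‖ψ' − ψ‖² ≤ V⁺ψ' ≤ V⁺ψ + DV⁺(ψ)(ψ' − ψ) + b‖ψ' − ψ‖²` (§1 and (32) `neg_log_stepIntegral_le_of_growth`,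
whose linear term is the same `DV⁺(ψ)` by (33)). [folklore] -/
theorem stepMarginal_twoSided {K₂ : Set (EuclideanSpace ℝ (Fin n))} (hK₂m : MeasurableSet K₂) (hK₂c : Convex ℝ K₂)
    (hK₂b : IsBounded K₂) (hK₂v : 0 < volume K₂)
    {V : EuclideanSpace ℝ (Fin n) → ℝ} {G : EuclideanSpace ℝ (Fin m) → ℝ} (hVc : Continuous V) (hG1 : ContDiff ℝ 1 G)
    {a σ κ b : ℝ} (hV : StrongConvexOn K₂ σ V) (hG : StrongConvexOn univ a G) (hσ : 0 ≤ σ) (hD : 0 < σ + a * κ ^ 2)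
    (hGs : ∀ w w', G w' ≤ G w + fderiv ℝ G w (w' - w) + b * ‖w' - w‖ ^ 2)
    (Q : EuclideanSpace ℝ (Fin n) →ₗ[ℝ] EuclideanSpace ℝ (Fin m)) (hQ : ∀ y, ‖Q y‖ ≤ κ * ‖y‖) (x x' : EuclideanSpace ℝ (Fin m)) :
    (-log (∫ y in K₂, exp (-(V y + G (x - Q y)))) +
          ((∫ y in K₂, exp (-(V y + G (x - Q y))))⁻¹ • ∫ y in K₂, exp (-(V y + G (x - Q y))) • fderiv ℝ G (x - Q y)) (x' - x) +
          a * σ / (σ + a * κ ^ 2) / 2 * ‖x' - x‖ ^ 2 ≤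
        -log (∫ y in K₂, exp (-(V y + G (x' - Q y))))) ∧
      -log (∫ y in K₂, exp (-(V y + G (x' - Q y)))) ≤
        -log (∫ y in K₂, exp (-(V y + G (x - Q y)))) +
          (((∫ y in K₂, exp (-(V y + G (x - Q y))))⁻¹ • ∫ y in K₂, exp (-(V y + G (x - Q y))) • fderiv ℝ G (x - Q y)) (x' - x) +
            b * ‖x' - x‖ ^ 2) :=
  ⟨stepMarginal_firstOrder hK₂m hK₂c hK₂b hK₂v hVc hG1 hV hG hσ hD Q hQ x x',
    neg_log_stepIntegral_le_of_growth hK₂b hK₂v hVc hG1 hGs Q x x'⟩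

/-! ## §3 The Gaussian step -/

/-- The Gaussian weight `(a∕2)‖·‖²` is `a`-strongly convex on any convex set (indeed with equality in the secant identity). [folklore] -/
theorem strongConvexOn_halfSqNorm {E : Type*} [NormedAddCommGroup E] [InnerProductSpace ℝ E] (a : ℝ) {s : Set E} (hs : Convex ℝ s) :
    StrongConvexOn s a fun v : E => a / 2 * ‖v‖ ^ 2 := by
  refine ⟨hs, fun x _ y _ t r _ _ htr => ?_⟩
  simp only [smul_eq_mul]
  have e : ‖t • x + r • y‖ ^ 2 = t * ‖x‖ ^ 2 + r * ‖y‖ ^ 2 - t * r * ‖x - y‖ ^ 2 := by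
    have hr' : r = 1 - t := by linarith
    subst hr'
    simp only [← real_inner_self_eq_norm_sq, inner_add_left, inner_add_right, inner_sub_left, inner_sub_right,
      real_inner_smul_left, real_inner_smul_right, real_inner_comm x y]
    ring
  rw [e]
  exact le_of_eq (by ring)

/-- **THE GAUSSIAN STEP, PINCHED BY THREE NUMBERS.**  `K₂ ⊆ ℝⁿ` convex, measurable, bounded, of positive volume; `V` continuous and
`σ`-strongly convex on `K₂` (`σ ≥ 0`); `G = (a∕2)‖·‖²` with `σ + aκ² > 0`; `‖Qφ‖ ≤ κ‖φ‖`.  Then for all `ψ, ψ'`, with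
`V⁺ψ = −log ∫_{K₂} e^{−(V φ + (a∕2)‖ψ − Qφ‖²)} dφ` and `D(ψ) = (∫_{K₂} e^{−U(ψ,·)})⁻¹ • ∫_{K₂} e^{−U(ψ,φ)} • (a • innerSL ℝ (ψ − Qφ)) dφ`:
`V⁺ψ + D(ψ)(ψ' − ψ) + (aσ∕(σ+aκ²))∕2·‖ψ' − ψ‖² ≤ V⁺ψ' ≤ V⁺ψ + D(ψ)(ψ' − ψ) + (a∕2)‖ψ' − ψ‖²`. [folklore] -/
theorem gaussianStepMarginal_twoSided {K₂ : Set (EuclideanSpace ℝ (Fin n))} (hK₂m : MeasurableSet K₂) (hK₂c : Convex ℝ K₂)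
    (hK₂b : IsBounded K₂) (hK₂v : 0 < volume K₂) {V : EuclideanSpace ℝ (Fin n) → ℝ} (hVc : Continuous V)
    {a σ κ : ℝ} (hV : StrongConvexOn K₂ σ V) (hσ : 0 ≤ σ) (hD : 0 < σ + a * κ ^ 2)
    (Q : EuclideanSpace ℝ (Fin n) →ₗ[ℝ] EuclideanSpace ℝ (Fin m)) (hQ : ∀ y, ‖Q y‖ ≤ κ * ‖y‖) (x x' : EuclideanSpace ℝ (Fin m)) :
    (-log (∫ y in K₂, exp (-(V y + a / 2 * ‖x - Q y‖ ^ 2))) +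
          ((∫ y in K₂, exp (-(V y + a / 2 * ‖x - Q y‖ ^ 2)))⁻¹ •
              ∫ y in K₂, exp (-(V y + a / 2 * ‖x - Q y‖ ^ 2)) • (a • innerSL ℝ (x - Q y))) (x' - x) +
          a * σ / (σ + a * κ ^ 2) / 2 * ‖x' - x‖ ^ 2 ≤
        -log (∫ y in K₂, exp (-(V y + a / 2 * ‖x' - Q y‖ ^ 2)))) ∧
      -log (∫ y in K₂, exp (-(V y + a / 2 * ‖x' - Q y‖ ^ 2))) ≤
        -log (∫ y in K₂, exp (-(V y + a / 2 * ‖x - Q y‖ ^ 2))) +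
          (((∫ y in K₂, exp (-(V y + a / 2 * ‖x - Q y‖ ^ 2)))⁻¹ •
                ∫ y in K₂, exp (-(V y + a / 2 * ‖x - Q y‖ ^ 2)) • (a • innerSL ℝ (x - Q y))) (x' - x) +
            a / 2 * ‖x' - x‖ ^ 2) := by
  have h := stepMarginal_twoSided (G := fun v : EuclideanSpace ℝ (Fin m) => a / 2 * ‖v‖ ^ 2) hK₂m hK₂c hK₂b hK₂v hVc
    (contDiff_gaussian a) (b := a / 2) hV (strongConvexOn_halfSqNorm a convex_univ) hσ hD
    (fun w w' => by rw [fderiv_gaussian]; exact gaussian_growth a w w') Q hQ x x'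
  simp only [fderiv_gaussian] at h
  exact h

/-! ## §4 Sanity (decided toy) -/

/-- Toy (numbers only; v1.1 — the v1 toy asserted a false equation, located by chair leaf-05 g152 X-FSL RETURN-1): at `σ = a = 2`, `κ = 1`
the lower modulus is `aσ∕(σ+aκ²) = 1` and the Gaussian growth constant is `a∕2 = 1`, so in Hessian terms the next action is pinched in
`[1, 2]` (`λ⁺ ≤ D²V⁺ ≤ 2b`) — NOT tight: the sharp upper value `aσ∕(2(σ+aκ²)) = ½` would need `V`'s curvature, which (32)'s `b = a∕2` drops. -/
example : (2 : ℝ) * 2 / (2 + 2 * 1 ^ 2) = 1 ∧ (2 : ℝ) / 2 = 1 := by norm_num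

end Summit.QuantumFields.BalabanUV.T4Continuum.NE7b.FluctuationStepLetters
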